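import Summits.BirchSwinnertonDyer.Rank1Residual.Additive.RamifiedSevenGenusKatoPinnedFrame
import Summits.BirchSwinnertonDyer.Rank1Residual.Additive.RamifiedSevenPrimitiveAdmissibleMember
import HarnessLib

set_option autoImplicit false

/-!
# `𝒞₇` genus road (crux `EllipticUnitValueSevenOfGZK`, K7r), row (K2C-1) block (P3): crux K2ᶜ AT THE PINNED FRAME is
# Kato's INTEGRAL comparison (15.16.1)∘15.14 at the split hull — the shape `IntegralComparisonShape`, its splitting into
# the PRINT part `RationalComparisonShape` ((15.16.1) after `⊗ℚ`) and the research kernel `ComparisonDivisibilityShape`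
# (integrality of the constant), and the reductions «pinned integral comparison ⇒ K2cPinned ⇒ (B3)'s `hK2c` ⇒ RNV7 / 2★»;
# THEOREMS + three `Prop`-valued predicates on a pinned frame; nothing asserted, no named fact

Cell bsd-cm, seat bsd-cm-prr-ty1 g29 (literature-prover), SUMMON `wake/SUMMON-bsd-cm-prr-ty1-20260830T1331Z.md`
(5310ddf656b65669) block (P3); planner D887 (κ′)/D889/D890; reading note `Cruxes/EllipticUnitValueSevenOfGZK/K2cCollapse-g57.md`
§1 (C1)–(C4), §2 (LEMMA S, THEOREM); frozen memo `MEMO-bsd-cm-genus` v1 (a38f3eedd2c92d58) §4 LEMMA L, §5, §9 (G7′).  Imports: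
block (P1) `RamifiedSevenGenusKatoPinnedFrame` (the pinned frame, the «K2cPinned» letter, `hK2c_of_k2cPinned`) and block (B4)
`RamifiedSevenPrimitiveAdmissibleMember` (2★ from the genus inputs).  HONEST LABEL: predicates and conditional theorems; the
integral comparison is NOT asserted (it is the pen's research stub, re-cut); nothing about Kato's Conj. 12.10,
`X12.CMRamifiedSeven` or BSD is asserted; stmt-BirchSwinnertonDyer-19945 is OPEN; no summit statement is proved by this
seat; BSD is claimed for no curve.

## What the registered stub becomes (numbers, not adjectives)

At a PINNED frame `Φ : PinnedKatoGenusFrame W K hK I d` ((P1): `frame.HS = 𝐇′(S′_W) = H¹_Iw(Kℚ_∞/K, T₇W)` = the tree's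
`IK.H`, `j = res`, `π = √−7` through the CM endomorphism, `frame.EU 𝔟` = the Prop-15.9-pinned class of the `𝔟`-elliptic
units, `frame.zeta = t·zS` against ★), crux K2ᶜ's weak form `ResidueIsGenusUnitClassShape Φ.toKatoGenusFrame` READS:
**`IntegralComparisonShape Φ` :≡ for every admissible twist `𝔟`, `EU_𝔟 = C_𝔟 · 𝐳_{γ′}` with `C_𝔟 ∈ Λ_O`** — Kato's
(15.16.1)∘15.14 («the homomorphism (15.12.1) sends `z_{p^∞𝔣} ⊗ γ ⊗ ζ^{⊗(−1)}` to `z^{(p)}_{γ′}`», i.e. `EU_𝔞 = (N𝔞 − σ_𝔞)·𝐳_{γ′}`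
up to the constant) read INTEGRALLY at the split hull.  Kato PROVES the comparison after `⊗ℚ`: both sides lie in the branch
`𝐇′(𝒱′)`, free of rank one over `Λ_O ⊗ ℚ` (Thm. 12.4 (2) — on the rank-one rows a TREE theorem, `K2cCollapse-g57.md` §2), their
dual-exponential values agree at almost every character (Prop. 15.9 = the (λ1) pin; Thm. 12.5 (1) = the ★-pin through
`res`; Artin formalism `L(f_D, χ, s) = L(ψ_D·(χ∘N), s)`), and elements of a rank-one branch are separated by their values
(LEMMA S, Rohrlich 13.5) — this is **`RationalComparisonShape Φ` :≡ `∃ m, π^m · EU_𝔟 ∈ Λ_O · 𝐳_{γ′}`** (PRINT + the two pins; not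
proved in this file: the value-comparison needs the dual-exponential functionals on `A`, which the frame does not carry —
recorded as the pen's print-side input).  What print does NOT give is the INTEGRALITY of the constant — 15.14's «similarly»
for `K ⊂ ℚ(ζ_{p^∞})` — **`ComparisonDivisibilityShape Φ` :≡ whenever `π^m · EU_𝔟 = C · 𝐳_{γ′}`, `π^m ∣ C` in `Λ_O`**: THE research
kernel (expected: the constant is `u·x_𝔟`, `u ∈ {±1, ±2}` from the index-2 coset step of 15.14, `x_𝔟 = N𝔟 − σ̃_𝔟`; `K2cCollapse-g57.md`
§2 nit n1).  PROVED HERE (pure algebra on the frame): `Integral ⇒ Rational`; `Rational ∧ Divisibility ⇒ Integral`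
(`π`-torsion-freeness of `𝐇′(𝒱′)`); `Integral ⇒ Divisibility` when `𝐳_{γ′}` has trivial annihilator; and the chain
«(∃ pinned `Φ`, Rational ∧ Divisibility) ⇒ (∃ pinned `Φ`, Integral) = K2cPinned ⇒ (B3)'s `hK2c` ⇒ RNV7 ⇒ 2★ (ii)», plus the
unpacking of the (λ1) pin used by the print side ((Z1)/(Z2) norm-compatibility + integrality over the WHOLE ray-class tower;
(Z4)/(Z5) the value law on the cyclotomic layers).  CONSTRUCTION STATUS of the pinned frame's NON-research fields (for the
pen; each with its tree pointer): `Kcm`/`𝔣`/`𝔞`/`φ` (CM data of the member: `X12.ClassCSeven` ⇒ `HasCM`, `cmFieldDiscrOfJ = −7`),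
`γK` (surjectivity of `K.restrictOfFinrankEqTwo _ Kcm _`), `IK` (`nonempty_iwasawaH1DataOver`), `j`
(`IwasawaH1Data.resOver`), `zOne`/`k` (★ `exists_zetaClassPosition_of_rank_le_one` under GZK, as (B4) (α)), `R = Λ_O`,
`A = IK.H[1/7]` with the CM `Λ_O`-structure (`piK` of (P1) transported: functoriality `mapH1AddHom` + `IwasawaH1DataOver.proj_*`;
NOT yet assembled — size M), `torsionFree_π` (⟸ `IK.H` has no `7`-torsion ⟸ `W(Kℚ_∞)[7] = 0`; tree `IwasawaH1Data.isTorsionFree`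
pattern — `K`-side twin NOT in tree), `euK`/`EU` + `ψ, ιC, Ω, 𝔏` (named fact `CM.prop159_ellipticUnits_expStar_values` for the
maximal-order members `j = −3375`; the order-of-conductor-2 members `j = 16581375` need its `-- TODO(general form)`),
`isRayClassLayer_layer` (`Kℚ_n ⊂ K(W[7^{n+1}])`, Weil pairing; NOT in tree as stated), `bad_iff_dvd` (reduction types of
`(49a_i)^{(D)}`; tree BED files).  RESEARCH fields: the lattice datum `(zS, u, a, t)` with `zeta_eq`/`j_zOne` (Kato's
(L3)+§5; `a = a_W`), `EU_not_mem_of_residue` (the FRAME LEMMA (F3)–(F4)/(G7′)(1)–(2) for the pinned `EU`), and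
`ComparisonDivisibilityShape` (the kernel).  (F∃) — the genus frame `(F, θu)` itself — stays folded in the letter (STATUS
CHECK (F4∃) 13:41:56Z).

## For the pen's zp v12 touch (planner D895): shared frame, and the print-input ledger of the rational comparison

SHARED FRAME: the split stubs MUST quantify over ONE pinned frame — the letter consumed by `k2cPinned_of_rational_of_divisibility`
below is the SINGLE existential `★ → GZK → ∀ W … ∃ (F, θu) pinned, ∀ d, ∃ Φ : PinnedKatoGenusFrame W K hK I d,
RationalComparisonShape Φ ∧ ComparisonDivisibilityShape Φ` (one `Φ` for both conjuncts); two independent existentials over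
different frames would NOT recombine (the comparison constant is frame-relative up to `Λ_O^×` and the lattice datum `a`).  If the
pen wants two registered stubs, the second must be stated RELATIVE to the first's witness (e.g. `∀ Φ, RationalComparisonShape Φ →
ComparisonDivisibilityShape Φ` over all pinned frames — a ∀-form, stronger than needed but recombinable by `fun Φ h => ⟨h, hD Φ h⟩`).
PRINT-INPUT LEDGER for `RationalComparisonShape` (what turns it into a theorem; one line each, for pricing): (r1) Prop. 15.9 values of
`EU_𝔟` — IN THE FRAME (`euK_spec`, tree predicate `CM.EllipticZetaBody`; the fact `CM.prop159_ellipticUnits_expStar_values` for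
`j = −3375` inhabits it); (r2) Thm. 12.5 (1) values of `zOne` — the tree's realised-family currency behind ★ (`Kato2004.HasRealisedZetaFamily`
/ `ZetaClassPosition`, fact `Kato2004.exists_eulerSystem_expStar_values` resp. `exists_zetaClassPosition_of_rank_le_one`); (r3) a
COMPATIBILITY of the `K`-side dual-exponential datum `Φ.𝔏` with the `ℚ`-side datum of (r2) under `res`/Shapiro (`exp*_{Kℚ_n} ∘ res =
exp*_{ℚ_n} ⊗ K`) — NOT in the frame and NOT in the tree (both data are abstract; with a DEFINED `exp*` it is an instance; the same
gap as leak (ℓ1′) of (P1)) — THIS is the one non-print, non-kernel input of the rational comparison as typed; (r4) rank-one separation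
(LEMMA S of `K2cCollapse-g57.md`): tree ingredients `LocPKummer.rank_integralH1_le_one` (GZK at `r_an = 1`) +
`IwasawaH1Data.rank_le_one_of_rank_integralH1_le_one` + Weierstrass preparation (finitely many zeros) — provable; (r5) generic
non-vanishing `L(f_D, χ, 1) ≠ 0` (Kato 13.5 = Rohrlich): tree `PSRohrlichAtLevel.rohrlich_primePow_of_isNewformOf` / fact
`Rohrlich1984_nonvanishing_twists`; (r6) Artin formalism `L(f_D ⊗ χ, s) = L(ψ_D·(χ∘N), s)` with matching depleted Euler factors at
`7` and `ℓ ∣ D` (memo LEMMA C): untwisted = the pin `ψ_LSeries`; twisted — not in the tree as stated (S).  So `stub_rationalComparisonSeven`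
prices as «(r3) + (r6)-twisted + assembly», everything else print/tree; `stub_comparisonDivisibilitySeven` is the kernel.

References: K. Kato, Astérisque 295 (2004) Prop. 15.9 (p. 258), (15.12.1)–(15.12.2) (pp. 262–263), 15.14 (p. 264), (15.16.1),
Prop. 15.17 (p. 265), Thm. 12.4 (2), Thm. 12.5 (1) (p. 221), 13.5 (p. 227) [Kato2004Asterisque]; memo §4, §5, §9; (P1), (B3),
(B4).
-/

noncomputable section

open scoped NumberField TensorProduct
open Field IsDedekindDomain NumberField
open Literature.NumberTheory.GaloisRepresentations
open Literature.NumberTheory.EllipticCurves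
open Literature.NumberTheory.EllipticCurves.Rank1Residual
open Literature.NumberTheory.EllipticCurves.IwasawaAlgebra
open Literature.NumberTheory.EllipticCurves.Kato2004
open Literature.NumberTheory.ComplexMultiplication.EllipticUnits
open Summit.BirchSwinnertonDyer.Rank1Residual

namespace Summit.BirchSwinnertonDyer.Rank1Residual.Additive.GenusSeven

section Frame

variable {W : WeierstrassCurve ℚ} [W.IsElliptic] [W.IsGloballyMinimal] [Fact (Nat.Prime 7)]
  [ContinuousSMul ℤ_[7] (W.tateModule 7)] {K : ZpExtension ℚ 7} {hK : K.IsCyclotomic}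
  {γ : Field.absoluteGaloisGroup ℚ} {I : IwasawaH1Data W 7 K γ}
  {F : GenusFrame} {θu : ∀ n : ℕ, globalUnitsOf (F.layer n)} {d : GenusDatum F θu}

/-! ## §1 The three shapes at a pinned frame -/

/-- **`IntegralComparisonShape Φ` — Kato's (15.16.1)∘15.14 at the split hull, read INTEGRALLY, at the PINNED frame**: for every
admissible twist `𝔟`, `EU_𝔟 = C_𝔟 • 𝐳_{γ′}` with `C_𝔟 ∈ Λ_O` (= crux K2ᶜ's weak form `ResidueIsGenusUnitClassShape` of (B1b) on
`Φ.toKatoGenusFrame`; the pins of (P1) make `EU_𝔟`, `𝐳_{γ′}`, `𝐇′(S′_W)` Kato's objects).  A predicate; NOT asserted.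
[cite: Kato2004Asterisque, §15.16 (15.16.1) (p. 265) and Prop. 15.17, proof, last line (p. 265, "similarly by using 15.14")] -/
def IntegralComparisonShape (Φ : PinnedKatoGenusFrame W K hK I d) : Prop :=
  ∀ 𝔟 : Ideal (𝓞 Φ.Kcm), IsTwist 7 Φ.𝔣 𝔟 → ∃ C : Φ.R, Φ.frame.EU 𝔟 = C • Φ.frame.zeta

/-- **`RationalComparisonShape Φ` — (15.16.1)∘15.14 AFTER `⊗ℚ`** (what Kato's argument proves: values agree + separation in the
rank-one branch): for every admissible `𝔟` there are `m` and `C ∈ Λ_O` with `π^m • EU_𝔟 = C • 𝐳_{γ′}`.  A predicate; NOT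
asserted (its derivation from Prop. 15.9 + Thm. 12.5 (1) + LEMMA S needs the dual-exponential functionals on `𝐇′(𝒱′)`, which
the frame does not carry). [cite: Kato2004Asterisque, §15.16 (15.16.1) (p. 265) with (15.12.2) (p. 263), Thm. 12.4 (2) (p. 221) and 13.5 (p. 227)] -/
def RationalComparisonShape (Φ : PinnedKatoGenusFrame W K hK I d) : Prop :=
  ∀ 𝔟 : Ideal (𝓞 Φ.Kcm), IsTwist 7 Φ.𝔣 𝔟 → ∃ (m : ℕ) (C : Φ.R), Φ.π ^ m • Φ.frame.EU 𝔟 = C • Φ.frame.zeta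

/-- **`ComparisonDivisibilityShape Φ` — THE RESEARCH KERNEL: integrality of the comparison constant** (15.14's «similarly»):
whenever `π^m • EU_𝔟 = C • 𝐳_{γ′}` with `C ∈ Λ_O`, then `π^m ∣ C`.  A predicate; NOT asserted.
[cite: Kato2004Asterisque, Prop. 15.17, proof, last line (p. 265, "similarly by using 15.14") and 15.14 (p. 264)] -/
def ComparisonDivisibilityShape (Φ : PinnedKatoGenusFrame W K hK I d) : Prop :=
  ∀ 𝔟 : Ideal (𝓞 Φ.Kcm), IsTwist 7 Φ.𝔣 𝔟 → ∀ (m : ℕ) (C : Φ.R),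
    Φ.π ^ m • Φ.frame.EU 𝔟 = C • Φ.frame.zeta → ∃ C' : Φ.R, C = Φ.π ^ m * C'

/-- `IntegralComparisonShape Φ` IS (B1b)'s weak form on the underlying frame (definitional). [cite: Kato2004Asterisque, §15.16 (15.16.1) (p. 265)] -/
theorem integralComparisonShape_iff (Φ : PinnedKatoGenusFrame W K hK I d) :
    IntegralComparisonShape Φ ↔ ResidueIsGenusUnitClassShape Φ.toKatoGenusFrame :=
  Iff.rfl

/-- The integral comparison read on the PINNED class `euK 𝔟 ∈ IK.H`: `ιS (euK 𝔟) = C • 𝐳_{γ′}`. [cite: Kato2004Asterisque, §15.16 (15.16.1) (p. 265) and Prop. 15.9 (p. 258)] -/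
theorem integralComparisonShape_iff_euK (Φ : PinnedKatoGenusFrame W K hK I d) :
    IntegralComparisonShape Φ ↔
      ∀ 𝔟 : Ideal (𝓞 Φ.Kcm), IsTwist 7 Φ.𝔣 𝔟 → ∃ C : Φ.R, Φ.ιS (Φ.euK 𝔟) = C • Φ.frame.zeta := by
  refine forall₂_congr fun 𝔟 h𝔟 => ?_
  rw [Φ.EU_eq 𝔟 h𝔟]

/-! ## §2 Integral ⇔ Rational ∧ Divisibility (pure algebra on the frame) -/

/-- Integral ⇒ Rational (`m = 0`). [cite: Kato2004Asterisque, §15.16 (15.16.1) (p. 265)] -/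
theorem IntegralComparisonShape.rational {Φ : PinnedKatoGenusFrame W K hK I d} (h : IntegralComparisonShape Φ) :
    RationalComparisonShape Φ := fun 𝔟 h𝔟 => by
  obtain ⟨C, hC⟩ := h 𝔟 h𝔟
  exact ⟨0, C, by rw [pow_zero, one_smul, hC]⟩

/-- **Rational ∧ Divisibility ⇒ Integral** — `π^m • (EU − C′ • 𝐳_{γ′}) = 0` and `𝐇′(𝒱′)` has no `π`-torsion
(`KatoGenusFrame.torsionFree_π_pow`).  The research kernel is exactly the divisibility.
[cite: Kato2004Asterisque, Thm. 12.4 (2) (p. 221, "torsion free") and §15.16 (15.16.1) (p. 265)] -/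
theorem integralComparisonShape_of_rational_of_divisibility {Φ : PinnedKatoGenusFrame W K hK I d}
    (hR : RationalComparisonShape Φ) (hD : ComparisonDivisibilityShape Φ) : IntegralComparisonShape Φ := by
  intro 𝔟 h𝔟
  obtain ⟨m, C, hC⟩ := hR 𝔟 h𝔟
  obtain ⟨C', rfl⟩ := hD 𝔟 h𝔟 m C hC
  refine ⟨C', sub_eq_zero.mp (Φ.torsionFree_π_pow m _ ?_)⟩
  rw [smul_sub, hC, mul_smul, sub_self]

/-- **Integral ⇒ Divisibility when `𝐳_{γ′}` has trivial annihilator in `Λ_O`** (in Kato's frame: `𝐳_{γ′} ≠ 0` in the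
torsion-free rank-one `𝐇′(𝒱′)` over the domain `Λ_O`, Thm. 12.4 (2)/13.5): from `EU = C₀ • 𝐳` and `π^m • EU = C • 𝐳`,
`(π^m C₀ − C) • 𝐳 = 0`. [cite: Kato2004Asterisque, Thm. 12.4 (2) (p. 221) and 13.5 (p. 227)] -/
theorem IntegralComparisonShape.divisibility {Φ : PinnedKatoGenusFrame W K hK I d} (h : IntegralComparisonShape Φ)
    (hz : ∀ r : Φ.R, r • Φ.frame.zeta = 0 → r = 0) : ComparisonDivisibilityShape Φ := by
  intro 𝔟 h𝔟 m C hC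
  obtain ⟨C₀, hC₀⟩ := h 𝔟 h𝔟
  refine ⟨C₀, ?_⟩
  have h0 : (C - Φ.π ^ m * C₀) • Φ.frame.zeta = 0 := by
    rw [sub_smul, ← hC, hC₀, smul_smul, sub_self]
  exact sub_eq_zero.mp (hz _ h0)

/-- Hence, when `𝐳_{γ′}` has trivial annihilator: Integral ⇔ Rational ∧ Divisibility. [cite: Kato2004Asterisque, §15.16 (15.16.1) (p. 265)] -/
theorem integralComparisonShape_iff_rational_and_divisibility {Φ : PinnedKatoGenusFrame W K hK I d}
    (hz : ∀ r : Φ.R, r • Φ.frame.zeta = 0 → r = 0) :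
    IntegralComparisonShape Φ ↔ RationalComparisonShape Φ ∧ ComparisonDivisibilityShape Φ :=
  ⟨fun h => ⟨h.rational, h.divisibility hz⟩, fun h => integralComparisonShape_of_rational_of_divisibility h.1 h.2⟩

/-- Under the integral comparison (and a non-zero genus residue) the split-vertex class is `π`-indivisible in `𝐇′(S′_W)` —
(K2_S) at the pinned frame ((B1b) `zS_ne_pi_smul`). [cite: Kato2004Asterisque, §15.16 (15.16.1) (p. 265) with Thm. 12.4 (2) (p. 221)] -/
theorem IntegralComparisonShape.zS_ne_pi_smul {Φ : PinnedKatoGenusFrame W K hK I d} (h : IntegralComparisonShape Φ)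
    (hres : GenusResidueNonzeroShape d) : ∀ x ∈ Φ.frame.HS, Φ.zS ≠ Φ.π • x :=
  Φ.toKatoGenusFrame.zS_ne_pi_smul h hres

/-- … in `IK.H`-coordinates: `zS ≠ π • ιS y` for every `y ∈ H¹_Iw(Kℚ_∞/K, T₇W)`. [cite: Kato2004Asterisque, 15.14 (p. 264) and (15.16.1) (p. 265)] -/
theorem IntegralComparisonShape.zS_ne_pi_smul_ιS {Φ : PinnedKatoGenusFrame W K hK I d} (h : IntegralComparisonShape Φ)
    (hres : GenusResidueNonzeroShape d) (y : Φ.IK.H) : Φ.zS ≠ Φ.π • Φ.ιS y :=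
  h.zS_ne_pi_smul hres _ (Φ.ιS_mem y)

/-! ## §3 The (λ1) pin unpacked for the print side: the classes of `EU_𝔟` over the whole ray-class tower and their values -/

namespace PinnedKatoGenusFrame

variable (Φ : PinnedKatoGenusFrame W K hK I d)

/-- **The layer classes of `EU_𝔟` are norm-compatible over the WHOLE ray-class tower and INTEGRAL** ((Z1)/(Z2) of the body) —
the property no cyclotomic-only class has (module docstring «(κ-check)»). [cite: Kato2004Asterisque, §15.5 (p. 253, norm relation) and §15.6 (15.6.3) (pp. 253–254)] -/
theorem exists_normCompatible_integral_of_isTwist {𝔟 : Ideal (𝓞 Φ.Kcm)} (h𝔟 : IsTwist 7 Φ.𝔣 𝔟) :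
    ∃ w : ∀ U : Subgroup (absoluteGaloisGroup Φ.Kcm), H1 (CM.tateRepK (W.baseChange Φ.Kcm) 7) U,
      (∀ (U U' : Subgroup (absoluteGaloisGroup Φ.Kcm)) (hU : CM.IsRayClassLayer (W.baseChange Φ.Kcm) 7 (7 * F.d) U),
        CM.IsRayClassLayer (W.baseChange Φ.Kcm) 7 (7 * F.d) U' → ∀ h : U ≤ U',
          CM.layerCores (CM.tateRepK (W.baseChange Φ.Kcm) 7) h hU.isOpen (w U) = w U') ∧
      (∀ U : Subgroup (absoluteGaloisGroup Φ.Kcm), CM.IsRayClassLayer (W.baseChange Φ.Kcm) 7 (7 * F.d) U →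
        w U ∈ CM.integralH1K (CM.tateRepK (W.baseChange Φ.Kcm) 7) 7 U) ∧
      ∀ n : ℕ, Φ.IK.proj n (Φ.euK 𝔟) = w ((K.restrictOfFinrankEqTwo (by decide) Φ.Kcm Φ.finrank_Kcm).layerSubgroup n) := by
  obtain ⟨w, y, hbody, hproj, -⟩ := Φ.exists_body_of_isTwist h𝔟
  exact ⟨w, hbody.1, hbody.2.1, hproj⟩

/-- The value law (15.9.1) on the cyclotomic layer `Kℚ_n` for the classes of `EU_𝔟` ((Z4)+(Z5) of the body at the
ray-class layer `Kℚ_n`). [cite: Kato2004Asterisque, Prop. 15.9 and (15.9.1) (pp. 258–259)] -/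
theorem exists_valueLaw_layer_of_isTwist {𝔟 : Ideal (𝓞 Φ.Kcm)} (h𝔟 : IsTwist 7 Φ.𝔣 𝔟) (n : ℕ) :
    ∃ (w : ∀ U : Subgroup (absoluteGaloisGroup Φ.Kcm), H1 (CM.tateRepK (W.baseChange Φ.Kcm) 7) U)
      (y : Subgroup (absoluteGaloisGroup Φ.Kcm) → AlgebraicClosure Φ.Kcm),
      Φ.IK.proj n (Φ.euK 𝔟) = w ((K.restrictOfFinrankEqTwo (by decide) Φ.Kcm Φ.finrank_Kcm).layerSubgroup n) ∧
      Φ.𝔏 _ (w ((K.restrictOfFinrankEqTwo (by decide) Φ.Kcm Φ.finrank_Kcm).layerSubgroup n)) =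
        (1 : ℚ_[7]) ⊗ₜ[ℤ] y ((K.restrictOfFinrankEqTwo (by decide) Φ.Kcm Φ.finrank_Kcm).layerSubgroup n) ∧
      ∀ (χ : absoluteGaloisGroup Φ.Kcm →ₜ* ℂˣ), (∀ σ ∈ (K.restrictOfFinrankEqTwo (by decide) Φ.Kcm Φ.finrank_Kcm).layerSubgroup n, χ σ = 1) →
        ∀ Lf : ℂ → ℂ, CM.IsDepletedHeckeL Φ.ψ χ (7 * (7 * F.d)) Lf →
          CM.galoisCharSum ((K.restrictOfFinrankEqTwo (by decide) Φ.Kcm Φ.finrank_Kcm).layerSubgroup n) χ Φ.ιC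
              (y ((K.restrictOfFinrankEqTwo (by decide) Φ.Kcm Φ.finrank_Kcm).layerSubgroup n)) =
            (((Ideal.absNorm 𝔟 : ℕ) : ℂ) - CM.heckeCharIdealValue Φ.ψ 𝔟 * (heckeIdealValue χ 𝔟)⁻¹) *
              Φ.Ω⁻¹ * Lf 1 := by
  obtain ⟨w, y, hbody, hproj, -⟩ := Φ.exists_body_of_isTwist h𝔟
  obtain ⟨-, -, -, -, hZ4, hZ5⟩ := hbody
  exact ⟨w, y, hproj n, (hZ4 _ (Φ.isRayClassLayer_layer n)).2,
    fun χ hχ Lf hLf => hZ5 _ (Φ.isRayClassLayer_layer n) χ hχ Lf hLf⟩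

end PinnedKatoGenusFrame

end Frame

/-! ## §4 The reductions for the pen: pinned integral comparison ⇒ K2cPinned ⇒ `hK2c` ⇒ RNV7 ⇒ 2★ -/

/-- **«K2cPinned» FROM THE PINNED INTEGRAL COMPARISON** (definitional re-reading, `integralComparisonShape_iff`): the letter the
pen may register in zp v12 in place of `stub_residueIsGenusUnitClassSeven` is «★ → GZK → ∀ W ∈ 𝒞₇ ∀ (K, hK, γ, hγ, I), ∃ (F, θu)
value-pinned, ∀ d, ∃ Φ : PinnedKatoGenusFrame W K hK I d, IntegralComparisonShape Φ» (the `hIC` binder below), and it yields the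
«K2cPinned» letter of (P1) (the conclusion below, = the `hK2cP` binder of `hK2c_of_k2cPinned`).  CONDITIONAL; nothing asserted.
[cite: Kato2004Asterisque, §15.16 (15.16.1) (p. 265)] -/
theorem k2cPinned_of_integralComparison
    (hIC : exists_zetaClassPosition_of_rank_le_one → rank_eq_analyticRank_of_analyticRank_le_one →
      ∀ (W : WeierstrassCurve ℚ) [W.IsElliptic] [W.IsGloballyMinimal] [Fact (Nat.Prime 7)], X12.ClassCSeven W →
      letI : ContinuousSMul ℤ_[7] (W.tateModule 7) := TateModule.continuousSMul_padicInt
      ∀ (K : ZpExtension ℚ 7) (hK : K.IsCyclotomic) (γ : Field.absoluteGaloisGroup ℚ) (_ : K.IsTopGenerator γ)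
        (I : IwasawaH1Data W 7 K γ),
        ∃ (F : GenusFrame) (θu : ∀ n : ℕ, globalUnitsOf (F.layer n)), IsNormedEllipticUnitFamily F θu ∧
          ∀ d : GenusDatum F θu, ∃ Φ : PinnedKatoGenusFrame W K hK I d, IntegralComparisonShape Φ) :
    exists_zetaClassPosition_of_rank_le_one → rank_eq_analyticRank_of_analyticRank_le_one →
      ∀ (W : WeierstrassCurve ℚ) [W.IsElliptic] [W.IsGloballyMinimal] [Fact (Nat.Prime 7)], X12.ClassCSeven W →
      letI : ContinuousSMul ℤ_[7] (W.tateModule 7) := TateModule.continuousSMul_padicInt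
      ∀ (K : ZpExtension ℚ 7) (hK : K.IsCyclotomic) (γ : Field.absoluteGaloisGroup ℚ) (_ : K.IsTopGenerator γ)
        (I : IwasawaH1Data W 7 K γ),
        ∃ (F : GenusFrame) (θu : ∀ n : ℕ, globalUnitsOf (F.layer n)), IsNormedEllipticUnitFamily F θu ∧
          ∀ d : GenusDatum F θu, ∃ Φ : PinnedKatoGenusFrame W K hK I d,
            ResidueIsGenusUnitClassShape Φ.toKatoGenusFrame :=
  hIC

/-- **The same from the SPLIT inputs: print part (rational comparison) ∧ kernel (divisibility) at a pinned frame ⇒ «K2cPinned».**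
CONDITIONAL; nothing asserted. [cite: Kato2004Asterisque, §15.16 (15.16.1) (p. 265), Thm. 12.4 (2) (p. 221)] -/
theorem k2cPinned_of_rational_of_divisibility
    (hRD : exists_zetaClassPosition_of_rank_le_one → rank_eq_analyticRank_of_analyticRank_le_one →
      ∀ (W : WeierstrassCurve ℚ) [W.IsElliptic] [W.IsGloballyMinimal] [Fact (Nat.Prime 7)], X12.ClassCSeven W →
      letI : ContinuousSMul ℤ_[7] (W.tateModule 7) := TateModule.continuousSMul_padicInt
      ∀ (K : ZpExtension ℚ 7) (hK : K.IsCyclotomic) (γ : Field.absoluteGaloisGroup ℚ) (_ : K.IsTopGenerator γ)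
        (I : IwasawaH1Data W 7 K γ),
        ∃ (F : GenusFrame) (θu : ∀ n : ℕ, globalUnitsOf (F.layer n)), IsNormedEllipticUnitFamily F θu ∧
          ∀ d : GenusDatum F θu, ∃ Φ : PinnedKatoGenusFrame W K hK I d,
            RationalComparisonShape Φ ∧ ComparisonDivisibilityShape Φ) :
    exists_zetaClassPosition_of_rank_le_one → rank_eq_analyticRank_of_analyticRank_le_one →
      ∀ (W : WeierstrassCurve ℚ) [W.IsElliptic] [W.IsGloballyMinimal] [Fact (Nat.Prime 7)], X12.ClassCSeven W →
      letI : ContinuousSMul ℤ_[7] (W.tateModule 7) := TateModule.continuousSMul_padicInt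
      ∀ (K : ZpExtension ℚ 7) (hK : K.IsCyclotomic) (γ : Field.absoluteGaloisGroup ℚ) (_ : K.IsTopGenerator γ)
        (I : IwasawaH1Data W 7 K γ),
        ∃ (F : GenusFrame) (θu : ∀ n : ℕ, globalUnitsOf (F.layer n)), IsNormedEllipticUnitFamily F θu ∧
          ∀ d : GenusDatum F θu, ∃ Φ : PinnedKatoGenusFrame W K hK I d,
            ResidueIsGenusUnitClassShape Φ.toKatoGenusFrame := by
  intro hstar hGZK W _ _ _ hC K hK γ hγ I
  haveI : ContinuousSMul ℤ_[7] (W.tateModule 7) := TateModule.continuousSMul_padicInt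
  obtain ⟨F, θu, hpin, hΦ⟩ := hRD hstar hGZK W hC K hK γ hγ I
  refine ⟨F, θu, hpin, fun d => ?_⟩
  obtain ⟨Φ, hR, hD⟩ := hΦ d
  exact ⟨Φ, integralComparisonShape_of_rational_of_divisibility hR hD⟩

/-- **RNV7 (= p765067's `hK2` binder VERBATIM) from the pinned integral comparison**, the genus-residue input of (B3), ★ and
GZK. CONDITIONAL; nothing asserted; 19945 OPEN. [cite: Kato2004Asterisque, (15.16.1) (p. 265), Thm. 12.5 (1) (p. 221), Conj. 12.10 (p. 224)] -/
theorem residualNonvanishingSeven_of_integralComparison (hstar : exists_zetaClassPosition_of_rank_le_one)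
    (hGZK : rank_eq_analyticRank_of_analyticRank_le_one)
    (hRes : ∀ (F : GenusFrame) (θu : ∀ n : ℕ, globalUnitsOf (F.layer n)), IsNormedEllipticUnitFamily F θu →
      ∃ d : GenusDatum F θu, GenusResidueNonzeroShape d)
    (hIC : exists_zetaClassPosition_of_rank_le_one → rank_eq_analyticRank_of_analyticRank_le_one →
      ∀ (W : WeierstrassCurve ℚ) [W.IsElliptic] [W.IsGloballyMinimal] [Fact (Nat.Prime 7)], X12.ClassCSeven W →
      letI : ContinuousSMul ℤ_[7] (W.tateModule 7) := TateModule.continuousSMul_padicInt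
      ∀ (K : ZpExtension ℚ 7) (hK : K.IsCyclotomic) (γ : Field.absoluteGaloisGroup ℚ) (_ : K.IsTopGenerator γ)
        (I : IwasawaH1Data W 7 K γ),
        ∃ (F : GenusFrame) (θu : ∀ n : ℕ, globalUnitsOf (F.layer n)), IsNormedEllipticUnitFamily F θu ∧
          ∀ d : GenusDatum F θu, ∃ Φ : PinnedKatoGenusFrame W K hK I d, IntegralComparisonShape Φ) :
    ∀ (W : WeierstrassCurve ℚ) [W.IsElliptic] [W.IsGloballyMinimal] [Fact (Nat.Prime 7)], X12.ClassCSeven W →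
      letI : ContinuousSMul ℤ_[7] (W.tateModule 7) := TateModule.continuousSMul_padicInt
      ∀ (K : ZpExtension ℚ 7) (hK : K.IsCyclotomic) (γ : Field.absoluteGaloisGroup ℚ) (_ : K.IsTopGenerator γ)
        (I : IwasawaH1Data W 7 K γ) (z₀ : I.H), Kato2004.IsAdmissibleZetaClass W 7 K hK I z₀ →
        z₀ ∉ (IwasawaAlgebra.augIdealP 7 • (⊤ : Submodule (IwasawaAlgebra 7) I.H)) :=
  residualNonvanishingSeven_of_k2cPinned hstar hGZK hRes (k2cPinned_of_integralComparison hIC)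

/-- **STUB 2★ (zp v10a/v11 `stub_primitiveAdmissibleMemberSeven` TYPE, as derived in (B4)) from the genus inputs with K2ᶜ in
its PINNED INTEGRAL-COMPARISON form** — (B4)'s `primitiveAdmissibleMemberSeven_of_genus` with `hK2c := hK2c_of_k2cPinned …
(k2cPinned_of_integralComparison hIC)`.  CONDITIONAL on ★, GZK, the three printed facts of (G6), K1ᵘ (oriented), the pinned
K2ᶜ letter `hIC` and (E2); nothing asserted; 19945 OPEN.
[cite: Kato2004Asterisque, Thm. 12.5 (1)(4) (pp. 221–222), (15.16.1) (p. 265), Conj. 12.10 (p. 224)] [cite: Tsuji1999, Thm 3.1 (i) (p. 6)]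
[cite: FerreroWashington1979, main theorem] -/
theorem primitiveAdmissibleMemberSeven_of_integralComparison (hstar : exists_zetaClassPosition_of_rank_le_one)
    (hGZK : rank_eq_analyticRank_of_analyticRank_le_one)
    (h₄ : Literature.NumberTheory.IwasawaTheory.tsuji1999_thm31_colemanMap)
    (h₂ : Literature.NumberTheory.IwasawaTheory.ferreroWashington_kubotaLeopoldtSeries_unitCoeff)
    (h₂' : Literature.NumberTheory.IwasawaTheory.ferreroWashington_stickelbergerSeries_unitCoeff)
    (hK1u : ∀ (F : GenusFrame) (θu : ∀ n : ℕ, globalUnitsOf (F.layer n)), IsNormedEllipticUnitFamily F θu →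
      ∃ d : OrientedGenusDatum F θu, OrientedGenusFactorisationShape d)
    (hIC : exists_zetaClassPosition_of_rank_le_one → rank_eq_analyticRank_of_analyticRank_le_one →
      ∀ (W : WeierstrassCurve ℚ) [W.IsElliptic] [W.IsGloballyMinimal] [Fact (Nat.Prime 7)], X12.ClassCSeven W →
      letI : ContinuousSMul ℤ_[7] (W.tateModule 7) := TateModule.continuousSMul_padicInt
      ∀ (K : ZpExtension ℚ 7) (hK : K.IsCyclotomic) (γ : Field.absoluteGaloisGroup ℚ) (_ : K.IsTopGenerator γ)
        (I : IwasawaH1Data W 7 K γ),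
        ∃ (F : GenusFrame) (θu : ∀ n : ℕ, globalUnitsOf (F.layer n)), IsNormedEllipticUnitFamily F θu ∧
          ∀ d : GenusDatum F θu, ∃ Φ : PinnedKatoGenusFrame W K hK I d, IntegralComparisonShape Φ)
    (hE2 : ∀ (W : WeierstrassCurve ℚ) [W.IsElliptic] [W.IsGloballyMinimal] [Fact (Nat.Prime 7)], X12.ClassCSeven W →
      ∃ (W' : WeierstrassCurve ℚ) (_ : W'.IsElliptic) (_ : W'.IsGloballyMinimal), WeierstrassCurve.IsIsogenous W W' ∧
        letI : ContinuousSMul ℤ_[7] (W'.tateModule 7) := TateModule.continuousSMul_padicInt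
        ∀ (K : ZpExtension ℚ 7) (hK : K.IsCyclotomic) (γ : Field.absoluteGaloisGroup ℚ) (_ : K.IsTopGenerator γ)
          (I : IwasawaH1Data W' 7 K γ), Kato2004.HasMuFreeRealisedZetaFamily W' 7 K hK I) :
    ∀ (W : WeierstrassCurve ℚ) [W.IsElliptic] [W.IsGloballyMinimal] [Fact (Nat.Prime 7)], X12.ClassCSeven W →
      ∃ (W' : WeierstrassCurve ℚ) (_ : W'.IsElliptic) (_ : W'.IsGloballyMinimal), WeierstrassCurve.IsIsogenous W W' ∧
        letI : ContinuousSMul ℤ_[7] (W'.tateModule 7) := TateModule.continuousSMul_padicInt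
        (∃ (K : ZpExtension ℚ 7) (hK : K.IsCyclotomic) (γ : Field.absoluteGaloisGroup ℚ) (_ : K.IsTopGenerator γ)
          (I : IwasawaH1Data W' 7 K γ) (z₀ : I.H), Kato2004.IsAdmissibleZetaClass W' 7 K hK I z₀) ∧
        (∀ (K : ZpExtension ℚ 7) (hK : K.IsCyclotomic) (γ : Field.absoluteGaloisGroup ℚ) (_ : K.IsTopGenerator γ)
          (I : IwasawaH1Data W' 7 K γ) (z₀ : I.H), Kato2004.IsAdmissibleZetaClass W' 7 K hK I z₀ →
          z₀ ∉ (IwasawaAlgebra.augIdealP 7 • (⊤ : Submodule (IwasawaAlgebra 7) I.H))) :=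
  primitiveAdmissibleMemberSeven_of_genus hstar hGZK h₄ h₂ h₂' hK1u
    (hK2c_of_k2cPinned hstar hGZK (k2cPinned_of_integralComparison hIC)) hE2

end Summit.BirchSwinnertonDyer.Rank1Residual.Additive.GenusSeven

end
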